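import Summits.ABC.ABC.Theses.PadicPrimesW80TwoThirds
import Summits.ABC.StewartYu.YuNinetyW80Transfer
import Summits.ABC.StewartYu.PadicTwistFinal

/-! # Crux `W80ThreeModFour` (stmt-ABC-19485, routes `PadicPrimesW80TwoThirds` / `PadicPrimesW80OddRadOne`)
# — line `twist-w80` (lead p2-g2): the registered skeleton with its one stub PROVED

`Summits/ABC/ABC/Theorems/PadicPrimesW80TwoThirdsW80ThreeModFour.lean` — cell `abc-stewartyu`.
The registered stub `stub_engineW80` (the Waldschmidt-shape twist engine at `p ≡ 3 (mod 4)`,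
verbatim the hypothesis `hE` of p3's landed transfer `YuNinetyW80.threeModFour_of_w80Engine`) is the
landed theorem `Summit.ABC.StewartYu.TwistSetup.engineThreeModFourW80` (the twisted `p`-adic Waldschmidt descent
`Summits/ABC/StewartYu/PadicTwist{Setup,…,Final}.lean` on p1's `(log p)`-normalised parameter
ledger `PadicW80ParL*`), and the composition is p3's transfer.  Everything is [folklore] assembly.
-/

set_option linter.dupNamespace false

namespace Summit.ABC.ABC.Cruxes.W80ThreeModFour.TwistW80

open Summit.ABC.ABC.Theses.PadicPrimesW80TwoThirds

/-- COMPOSITION: the crux BY NAME — the registered stub `stub_engineW80` IS the landed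
`Summit.ABC.StewartYu.TwistSetup.engineThreeModFourW80` (same statement), fed to p3's transfer. [folklore] -/
theorem W80ThreeModFour_of : W80ThreeModFour :=
  Summit.ABC.StewartYu.YuNinetyW80.threeModFour_of_w80Engine
    Summit.ABC.StewartYu.TwistSetup.engineThreeModFourW80

end Summit.ABC.ABC.Cruxes.W80ThreeModFour.TwistW80

namespace Summit.ABC.ABC.Theorems

/-- **Item `W80ThreeModFour` (stmt-ABC-19485)**: the Waldschmidt-shape `p`-adic bound for rational
primes at `p ≡ 3 (mod 4)`. [folklore] -/
theorem padicPrimesW80TwoThirds_w80ThreeModFour_proof :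
    Summit.ABC.ABC.Theses.PadicPrimesW80TwoThirds.W80ThreeModFour :=
  Summit.ABC.ABC.Cruxes.W80ThreeModFour.TwistW80.W80ThreeModFour_of

end Summit.ABC.ABC.Theorems
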